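import Summits.QuantumFields.YangMills.Theorems.BalabanUVNodesSpineRates
import Summits.QuantumFields.YangMills.Theorems.BalabanUVNodesN19LedgerLinkSync
import Summits.QuantumFields.YangMills.Theorems.BalabanUVNodesN16Shape

/-!
# BalabanUVNodes ∕ N19 — THE IN-EDGES N16 AND N17 AT THE N19 EDGE, BY NAME: the consumer-side conversions of the tree APPLIED at module 2's
# letters — `N17At D u` (NE4 on the datum) ⟶ node U2's OUTPUT `InjectedRate` on the record's coupling tables; `N16At c` (NE3's covariant root)
# ⟶ NE3's readings shape `NE3Shape` ∧ the liaison `GaugeDominated` for the ledger's readings family (seat dag-n19-a gen 4; count-neutral)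

WHY.  Cluster K4's conclusion for one string is `RatesAt D R = N14At R.ne1 ∧ N15At R.ne2 ∧ N16At R.ne3 ∧ N17At D R.u3 ∧ N18At R.u3 ∧ N22At R.u3`
(module 2 `BalabanUVNodesSpineRates`).  The N19′ rate edge of record (`N19RateEdge.rateEdge_of_linkReading`, p421499) consumes N14 · N18 · N22 BY
NAME but reads N16 and N17 through two DISPLAYED liaison hypotheses — `NE3Shape Rd C₃ θ₃ ∧ GaugeDominated Rd uA uB` on an unnamed readings family,
and node U2's output `InjectedRate Cd 0 θc (disc (g K) (g (K+1)))` — leaving `N16At R.ne3`, `N17At D R.u3` (and `N15At`) UNCONSUMED (referee pin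
[DAGREFB-G5-READ-269], pub-ymgap INBOX l.11098).  THIS FILE applies the tree's consumer-side conversions at the carriers' letters:

* §1 **N17.**  `N17At D u` IS `T4CouplingMatching.ScaleShiftRate (u.cr·u.C₅·u.θ) u.ρ u.γ D.βfun` (definitionally, through `Spine.NE4.NE4OnData`).
  With the identification «the record's coupling tables are (0.20)-runs of the datum» (`∀ K, RGEqH K D.βfun (g K)`), the box, the infrared pin
  `g K K = gIR`, the β-HISTORY companions (`HistLipschitz` ∕ `FadingMemory` of `D.βfun`), the eventual lower bound `EventualLowerH b u.γ k₀ D.βfun`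
  (β-window side) and the smallness window, `T4CouplingMatching.injectedRate_of_runs_eventual` gives node U2's output on the tables
  (`injectedRate_of_n17At`).  The two history companions come BY NAME from (D4) `ReadOutAt D u` + `N18At u` + `N22At u`
  (`Spine.NE4.Targets.u2Inputs_of_u3`, `histCompanions_of_readOutAt`); composite `injectedRate_of_n17At_readOutAt`.
* §2 **N16.**  `N16At c` IS `NE3EnergyRateWCov 4 (sfClass 4 c.L c.Nper c.ε) c.L c.Nper c.b c.g …` (module 2).  In THE END's regime letters (the
  numerals of dag-n16-a's `N16Shape.ne3Shape_of_n16`, `c.g = gradConst 4 c′`), WITH N07's interface `LeafH3sup` (the DAG edge N07 → N16 re-enters on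
  the consumer side: the covariant root quantifies over minimisers whose existence ∕ regularity is N07's — SAID, not hidden), the record's regular
  minimiser selection `sel`, a reading map `rd` from the ledger's fluctuation variable to the unit-lattice datum, NE7 route-#1's numeric side letters
  (`θ⁶ = L⁻¹`, `γ₃`, `l₁` of `NE3.CovariantRoot.closeness_of_ne3EnergyRateWCov`), an offset `k₀ ≥ 1`, and the GAUGE-DOMINATION CONVENTION in the
  faithful form «every presentation `gaugeAct u (sel (k₀+K) V) = vary (rescale L (bavg L (sel (k₀+K+1) V))) Z 1` (u unitary periodic, Z skew periodic)
  with `sup ‖Z‖ ≤ M` dominates U3's closeness gauge of `(uA K v, transport (uB K v))`» ([Balaban1987RG1] p. 263: the gauge of a pair IS such an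
  infimum; the realisation convention is UNPRINTED, cell GAPS G-t4-U1a-2), the ledger's readings family RE-LOCALISED at the geometric gauge profile
  carries `NE3Shape Rd′ C₃ θ₃ ∧ GaugeDominated Rd′ uA uB`, `θ₃ = max L⁻¹ θ⁸` (`ne3Liaison_of_covRoot`): ACTION half = `ne3Shape_of_n16` (b), POINTWISE
  half and domination = `closeness_of_ne3EnergyRateWCov` per level `k₀ + K ≥ 1`.
* §0 glue: `LedgerAtSync` reads the readings family only through `dom ∕ act ∕ vol` (`ledgerAtSync_withLoc`); monotonicity of `ActionRate` ∕ `NE3Shape`.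

HONEST FRAMING.  Count-neutral kernel bookkeeping over module 2's letters and hypothesis SHAPES; NE3 ∕ NE4 ∕ NE5 ∕ NE9 ∕ NE7 NOT PRINTED for Bałaban's
d = 4 procedure and NOT proved; every input is a BINDER; nothing of Bałaban's is instantiated; N16 ∕ N17 ∕ N19 NOT discharged; one finite four-torus
at fixed ε, rung (B)+1 — NOT infinite volume, NOT OS on ℝ⁴, NOT a mass gap, NOT Clay.  THEOREMS ONLY; 0 `def`; 0 `sorry`; standard axioms.
Printed context = LOCATIONS only: [Balaban1987RG1] CMP **109** (0.20) p. 256, Thm 2 p. 259, p. 263, §1 p. 264; [Balaban1985RegularSpaces] Thm 2 ∕ 4;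
[Balaban1985Variational] Thm 1 (8)–(10) p. 279; [King1986] Prop. 3.8 (3.71) p. 664 (template).  No decl below carries a cite tag.
-/

set_option autoImplicit false

noncomputable section

open scoped BigOperators Matrix Matrix.Norms.L2Operator
open Finset MeasureTheory NormedSpace

namespace Summit.QuantumFields.YangMills.BalabanUVNodes.N19InEdgesAtRecord

open Literature.MathematicalPhysics.QuantumFieldTheory.Balaban1983to89
open Literature.MathematicalPhysics.QuantumFieldTheory.Balaban1983to89.T4Continuum (T4Family FiniteEpsData)
open B7Prop1Explicit B7Prop2Explicit
open T4AveragingDeficitWall (IsSkewDir vary)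
open T4OutputRate (Carriers Functional NE5 NE9)
open T4EtaRateMin (Readings ActionRate LocalRate NE3Shape)
open T4RateLiaison (GaugeDominated)
open T4CouplingMatching (ScaleShiftRate HistLipschitz EventualLowerH disc injectedRate_of_runs_eventual)
open T4CauchySum (InjectedRate)
open T4RecentScale T4GoodClassBudget
open Summit.QuantumFields.BalabanUV.T4Continuum
open AveragingDeficitPeriodicCounting (IsPeriodicDir)
open AveragingDeficitDualResidual (dualC1 dualC2)
open AveragingDeficitDerivWallProof (wallConst)
open MinimalActionSandwich (IsMinimiser minAct)
open MinimalActionRate (Regular sfClass minActReadings)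
open MinimalActionRefine (RegularSup gradConst gradConst_nonneg)
open NE3EnergyShapes (IsUnitarySite IsPeriodicSite)
open NE3EnergyWeightedCovShape (NE3EnergyRateWCov)
open NE3.LeafIndexSockets (LeafH3sup)
open NE3.CovariantRoot (closeness_of_ne3EnergyRateWCov)
open Summit.QuantumFields.BalabanUV.T4Continuum.Spine
open Summit.QuantumFields.BalabanUV.T4Continuum.Spine.NE4 (NE4OnData U2Inputs u2Inputs_of_u3)
open Summit.QuantumFields.YangMills.BalabanUVNodes.N16 (ne3Shape_of_n16 thresholds45_four)
open NE7EtaBackgroundRefineThresholds (thresholds_four)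
open FlowStep (RGEqH)
open Summit.QuantumFields.YangMills.BalabanUVNodes.N19LedgerLinkSync (LedgerDataSync LedgerAtSync)
open YMDAG.UVSplit (Datum U3Carriers NE3Carriers N16At N17At N18At N22At ReadOutAt)

/-! ## §0 Glue [bookkeeping] -/

/-- `ActionRate` is monotone in the constant and the rate (`0 ≤ C ≤ C'`, `0 ≤ θ ≤ θ'`). [folklore] -/
theorem actionRate_mono {ι X : Type*} {R : Readings ι X} {C C' θ θ' : ℝ} (h : ActionRate R C θ) (hC : C ≤ C') (hθ0 : 0 ≤ θ)
    (hθ : θ ≤ θ') (hC0 : 0 ≤ C) : ActionRate R C' θ' := fun k V hV =>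
  (h k V hV).trans (mul_le_mul_of_nonneg_right
    (mul_le_mul hC (pow_le_pow_left₀ hθ0 hθ k) (pow_nonneg hθ0 k) (hC0.trans hC)) R.vol_nonneg)

/-- `NE3Shape` is monotone in the constant and the rate below `1`. [folklore] -/
theorem ne3Shape_mono {ι X : Type*} {R : Readings ι X} {C C' θ θ' : ℝ} (h : NE3Shape R C θ) (hC0 : 0 ≤ C) (hC : C ≤ C')
    (hθ : θ ≤ θ') (hθ'1 : θ' < 1) : NE3Shape R C' θ' :=
  ⟨h.rate_nonneg.trans hθ, hθ'1, actionRate_mono h.action hC h.rate_nonneg hθ hC0, h.pointwise.mono hC h.rate_nonneg hθ hC0⟩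

section WithLoc

variable {C : Carriers} [DecidableEq C.Dom] {F : Type*} {ι X : Type} [MeasurableSpace ι] {σ : Type*} [DecidableEq σ]
  {L : LedgerDataSync C F ι σ} {l₀ vol : ℝ} {T : ℕ → Finset σ} {Bad : ℕ → ℝ → Finset σ} {A B : ℕ → ℝ → σ → ℝ}
  {R : Readings ι X} {EA : Functional C C.BgA} {EB : Functional C C.BgB} {κ : ℝ} {g : ℕ → ℕ → ℝ}
  {uA : ℕ → ι → C.BgA} {uB : ℕ → ι → C.BgB} {ω θc θ₅ θ₃ : ℝ}

/-- **`LedgerAtSync` READS NE3's readings family ONLY THROUGH `dom`, `act`, `vol`** (the admissible data, the main-action factor of the other kinds'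
factorisation, the volume letter): it transfers verbatim to the family RE-LOCALISED at any local reading `loc′` on any site type `X′`. [folklore] -/
theorem ledgerAtSync_withLoc (h : LedgerAtSync L l₀ vol T Bad A B R EA EB κ g uA uB ω θc θ₅ θ₃) {X' : Type} (loc' : ℕ → ι → X' → ℝ) :
    LedgerAtSync L l₀ vol T Bad A B (⟨R.dom, R.act, loc', R.vol, R.vol_nonneg⟩ : Readings ι X') EA EB κ g uA uB ω θc θ₅ θ₃ :=
  ⟨h.fmtA, h.fmtB, h.int, h.off, h.all_sub, h.all_sc, h.all_mult, h.Cl_nonneg, h.recent, h.ofmtA, h.ofmtB, h.u5b, h.CO_nonneg, h.wO_nonneg,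
    h.orec, h.omult, h.cf_le, h.Cs_nonneg, h.posO, h.rvol, h.size, h.vol_nonneg, h.E₀_nonneg, h.a_pos, h.a_lt_one, h.sizeProfile, h.other,
    h.RO_le, h.rO_summable, h.one, h.cO_dev, h.rate_gt, h.θ₅_le, h.θ₃_le, h.rate_lt_one, h.rate_le_base, h.one_le_base⟩

end WithLoc

/-! ## §1 N17 AT THE N19 EDGE BY NAME: `N17At D u` ⟶ node U2's output `InjectedRate` on the record's coupling tables -/

section N17

variable {F : T4Family} {N : ℕ} [NeZero N]

/-- `N17At D u` is `ScaleShiftRate (u.cr·u.C₅·u.θ) u.ρ u.γ D.βfun` (module 2 ∘ `Spine.NE4.NE4OnData`, definitional). [folklore] -/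
theorem scaleShiftRate_of_n17At (D : Datum F N) {u : U3Carriers} (h : N17At D u) :
    ScaleShiftRate (u.cr * u.C₅ * u.θ) u.ρ u.γ D.βfun := h

/-- **N17 BY NAME ⟶ NODE U2's OUTPUT ON THE RECORD's TABLES.**  From `N17At D u` (NE4 on the datum at node U3's dependent letters), the
identification «the tables `g K` are (0.20)-runs of the datum» `∀ K, RGEqH K D.βfun (g K)`, the box `0 < g K i ≤ u.γ`, the infrared pin
`g K K = gIR`, β-history companions `HistLipschitz Λβ u.γ D.βfun` ∕ `FadingMemory Cβ u.ρ Λβ`, the eventual lower bound `EventualLowerH b u.γ k₀ D.βfun`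
and the window `Cβ((k₀+1)γ³ + 2γ∕b) ≤ (1−ρ)∕2` (`0 < u.ρ < 1`, `0 < u.γ`, `0 < b`, `0 ≤ u.cr·u.C₅·u.θ`, `0 ≤ Cβ`): node U2's output
`InjectedRate (2(cr·C₅·θ)∕(1−ρ)) 0 ρ (fun K j ↦ disc (g K) (g (K+1)) j)` — `T4CouplingMatching.injectedRate_of_runs_eventual` at `β := D.βfun`.
Every input a BINDER; N17 NOT discharged. [folklore] -/
theorem injectedRate_of_n17At (D : Datum F N) {u : U3Carriers} (h17 : N17At D u) {g : ℕ → ℕ → ℝ} {gIR b Cβ : ℝ} {k₀ : ℕ}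
    {Λβ : ℕ → ℕ → ℝ} (hγ : 0 < u.γ) (hb : 0 < b) (hρ0 : 0 < u.ρ) (hρ1 : u.ρ < 1) (hc : 0 ≤ u.cr * u.C₅ * u.θ) (hCβ : 0 ≤ Cβ)
    (hrun : ∀ K, RGEqH K D.βfun (g K)) (hbox : ∀ K i, i ≤ K → 0 < g K i ∧ g K i ≤ u.γ) (hpin : ∀ K, g K K = gIR)
    (hL : HistLipschitz Λβ u.γ D.βfun) (hΛ : T4CouplingMatching.FadingMemory Cβ u.ρ Λβ) (hlo : EventualLowerH b u.γ k₀ D.βfun)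
    (hsmall : Cβ * (((k₀ : ℝ) + 1) * u.γ ^ 3 + 2 * u.γ / b) ≤ (1 - u.ρ) / 2) :
    InjectedRate (2 * (u.cr * u.C₅ * u.θ) / (1 - u.ρ)) 0 u.ρ fun K j => disc (g K) (g (K + 1)) j :=
  injectedRate_of_runs_eventual g gIR hγ hb hρ0 hρ1 hc hCβ hrun hbox hpin (scaleShiftRate_of_n17At D h17) hL hΛ hlo hsmall

/-- **THE β-HISTORY COMPANIONS FROM (D4) · N18 · N22 BY NAME.**  (D4) `ReadOutAt D u` (the β-read-out binders at node U3's carriers — K4's stub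
letter `S_D4`), `N18At u` (NE5 at every member of run B's first-coupling family) and `N22At u` (NE9 ∧ fading memory of the OUTPUT moduli) give the
history moduli of the datum's β-functions `Λβ k i = u.cr · u.Λ (k+1) i` with `HistLipschitz Λβ u.γ D.βfun` and `FadingMemory (u.cr·u.C₉·u.ω) u.ρ Λβ`
— conjuncts 2–3 of `Spine.NE4.Targets.u2Inputs_of_u3` (whose first conjunct is N17 itself: module 2's `n17At_of_u3`). [folklore] -/
theorem histCompanions_of_readOutAt (D : Datum F N) {u : U3Carriers} (hD4 : ReadOutAt D u) (h18 : N18At u) (h22 : N22At u) :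
    HistLipschitz (fun k i => u.cr * u.Λ (k + 1) i) u.γ D.βfun ∧
      T4CouplingMatching.FadingMemory (u.cr * u.C₉ * u.ω) u.ρ (fun k i => u.cr * u.Λ (k + 1) i) ∧
      0 ≤ u.cr * u.C₅ * u.θ ∧ 0 ≤ u.cr * u.C₉ * u.ω := by
  obtain ⟨𝒜A, 𝒜B, rA, rB, hW, hA, hB, h𝒜A, h𝒜B, hr, hcov, hcr, hC₅, hθ, hω, hθρ, hωρ⟩ := hD4
  have hI : U2Inputs D (u.cr * u.C₅ * u.θ) (u.cr * u.C₉ * u.ω) u.ρ u.γ (fun k i => u.cr * u.Λ (k + 1) i) :=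
    u2Inputs_of_u3 D hW h18 h22.1 h22.2 hA hB h𝒜A h𝒜B hr hcov hcr hC₅ hθ hω hθρ hωρ
  exact ⟨hI.2.1, hI.2.2, mul_nonneg (mul_nonneg hcr hC₅) hθ,
    mul_nonneg (mul_nonneg hcr (T4BetaReadOut.fadingMemory_const_nonneg h22.2)) hω⟩

/-- **N17 · N18 · N22 · (D4) BY NAME ⟶ NODE U2's OUTPUT ON THE RECORD's TABLES** (composite of `injectedRate_of_n17At` and
`histCompanions_of_readOutAt`): the remaining binders are the (0.20)-run identification, the box, the infrared pin, the eventual lower bound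
`EventualLowerH b u.γ k₀ D.βfun` and the window `cr·C₉·ω·((k₀+1)γ³ + 2γ∕b) ≤ (1−ρ)∕2`, `0 < u.ρ < 1`, `0 < u.γ`, `0 < b`. [folklore] -/
theorem injectedRate_of_n17At_readOutAt (D : Datum F N) {u : U3Carriers} (h17 : N17At D u) (hD4 : ReadOutAt D u) (h18 : N18At u)
    (h22 : N22At u) {g : ℕ → ℕ → ℝ} {gIR b : ℝ} {k₀ : ℕ} (hγ : 0 < u.γ) (hb : 0 < b) (hρ0 : 0 < u.ρ) (hρ1 : u.ρ < 1)
    (hrun : ∀ K, RGEqH K D.βfun (g K)) (hbox : ∀ K i, i ≤ K → 0 < g K i ∧ g K i ≤ u.γ) (hpin : ∀ K, g K K = gIR)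
    (hlo : EventualLowerH b u.γ k₀ D.βfun)
    (hsmall : u.cr * u.C₉ * u.ω * (((k₀ : ℝ) + 1) * u.γ ^ 3 + 2 * u.γ / b) ≤ (1 - u.ρ) / 2) :
    InjectedRate (2 * (u.cr * u.C₅ * u.θ) / (1 - u.ρ)) 0 u.ρ fun K j => disc (g K) (g (K + 1)) j := by
  obtain ⟨hL, hΛ, hc, hC⟩ := histCompanions_of_readOutAt D hD4 h18 h22
  exact injectedRate_of_n17At D h17 hγ hb hρ0 hρ1 hc hC hrun hbox hpin hL hΛ hlo hsmall

end N17

/-! ## §2 N16 AT THE N19 EDGE BY NAME: the covariant root ⟶ `NE3Shape ∧ GaugeDominated` for the re-localised readings family -/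

section N16

variable {n : Type*} [Fintype n] [DecidableEq n] [Nonempty n]

omit [Fintype n] [DecidableEq n] [Nonempty n] in
/-- Fit bookkeeping: `γ₃θ² ≤ l₁N` gives `closeness_of_ne3EnergyRateWCov`'s fit `γ₃(θ^k)² ≤ l₁N` at every level `k ≥ 1` (`0 ≤ θ ≤ 1`, `0 ≤ γ₃`).
[folklore] -/
theorem fit_of_fit_one {γ₃ θ l₁ Nr : ℝ} (hγ : 0 ≤ γ₃) (hθ0 : 0 ≤ θ) (hθ1 : θ ≤ 1) (h : γ₃ * θ ^ 2 ≤ l₁ * Nr) {k : ℕ} (hk : 1 ≤ k) :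
    γ₃ * (θ ^ k) ^ 2 ≤ l₁ * Nr := by
  have hk' : θ ^ k ≤ θ := by
    calc θ ^ k ≤ θ ^ 1 := pow_le_pow_of_le_one hθ0 hθ1 hk
      _ = θ := pow_one θ
  exact (mul_le_mul_of_nonneg_left (pow_le_pow_left₀ (pow_nonneg hθ0 k) hk' 2) hγ).trans h

/-- **N16 BY NAME ⟶ NE3's READINGS SHAPE ∧ THE GAUGE LIAISON FOR THE LEDGER's READINGS FAMILY** [bookkeeping].  DATA∕HYPOTHESES.  THE END's regime
at `d = 4` (block factor `L ≥ 2`, period `Nper ≥ 1`, radii `0 ≤ b, c ≤ t` with ONE numeral `2^91·L^17·t ≤ 1`, class radius `2^76·L^12·t ≤ ε`,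
`16·C₀(4)·ε ≤ 3`, `1024·5·8·L²·ε ≤ 1`, data class `dom ⊆ sfClass 4 L Nper ε₁ 0` with `ε₁ ≤ 1∕4`, `ε₁ ≤ b`, `4ε₁ ≤ c`, `0 ≤ C`); N16's record decl
`h16 : NE3EnergyRateWCov 4 (sfClass 4 L Nper ε) L Nper b (gradConst 4 c) C Λ₁ Λ₂' dom` (= module 2's `N16At` at a bundle with `g = gradConst 4 c`);
N07's interface `h3 : LeafH3sup 4 L Nper ε b c dom`; the record's minimiser selection `sel` (`IsMinimiser` over `sfClass 4 L Nper ε` and `RegularSup … b c`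
at every level and datum of `dom` — inhabited: `N16Shape.ne3Shape_of_n16` (a)); NE7 route-#1's numeric side letters `0 < θ`, `θ⁶ = L⁻¹`, `0 < Λ₂'`,
`0 < γ₃` with `C·(wallConst 4 L·Nper²·(√(gradConst 4 c)·dualC2 4 L + 2b²·dualC1 4 L)) ≤ γ₃³`, `0 < l₁`, `Λ₁ ≤ l₁³`, the fit `γ₃θ² ≤ l₁·Nper`; a target
rate `θ₃ < 1` with `L⁻¹ ≤ θ₃`, `θ⁸ ≤ θ₃`; the ledger's readings family `Rd : Readings ι' X'` with a READING MAP `rd` from the fluctuation variable to the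
unit-lattice datum (`rd v ∈ dom` on `Rd.dom`), its action reading identified with the minimal action `Rd.act k v = minAct … k (rd v)` (the (2.25)
main-action factor), `Nper⁴ ≤ Rd.vol`; node U3's background maps `uA uB` on carriers `Car`, an offset `k₀ ≥ 1`, and the GAUGE-DOMINATION CONVENTION
`hdomc`: at run index `K` and admissible `v`, every presentation `gaugeAct u (sel (k₀+K) (rd v)) = vary (rescale L (bavg L (sel (k₀+K+1) (rd v)))) Z 1` with
`u` unitary `(Nper·L^{k₀+K})`-periodic, `Z` skew `(Nper·L^{k₀+K})`-periodic and `‖Z x κ‖ ≤ M` forces `Car.gauge (uA K v) (Car.transport (uB K v)) ≤ M`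
(UNPRINTED realisation convention; [Balaban1987RG1] p. 263).  CONCLUSION.  For some constant `C₃ ≥ 0` and some local reading `loc` (the geometric
gauge profile `K ↦ Σ_{i<K} 8l₁²γ₃·θ₃^i` on the one-point site type), the RE-LOCALISED family `⟨Rd.dom, Rd.act, loc, Rd.vol⟩` satisfies
`NE3Shape … C₃ θ₃` AND `GaugeDominated … uA uB` — the two N16-side hypotheses of the N19 knits (`N19LedgerLinkSync.core_summable_of_ledgerAtSync` ff.).
PROOF.  Action half: `ne3Shape_of_n16` (b) (`|A_{k+1}(V) − A_k(V)| ≤ C′·L^{−k}·Nper⁴`); pointwise half: the profile's increments are `8l₁²γ₃·θ₃^K`;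
domination: `NE3.CovariantRoot.closeness_of_ne3EnergyRateWCov` at level `k₀ + K ≥ 1` gives the presentation with `‖Z‖ ≤ 8l₁²γ₃·θ^{8(k₀+K)} ≤ 8l₁²γ₃·θ₃^K`,
then `hdomc`.  NE3 ∕ N16 ∕ N07 NOT proved: `h16`, `h3` are hypotheses; the convention is a binder. [folklore] -/
theorem ne3Liaison_of_covRoot {L Nper : ℕ} (hL : 2 ≤ L) (hN : 1 ≤ Nper) {ε ε₁ b c t C Λ₁ Λ₂' : ℝ}
    (hb : 0 ≤ b) (hc : 0 ≤ c) (hbt : b ≤ t) (hct : c ≤ t) (hC : 0 ≤ C)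
    (hsmall : (2 : ℝ) ^ 91 * (L : ℝ) ^ 17 * t ≤ 1) (hεt : (2 : ℝ) ^ 76 * (L : ℝ) ^ 12 * t ≤ ε)
    (hε1 : 16 * C0 4 * ε ≤ 3) (hε2 : 1024 * (4 + 1) * (4 + 4) * (L : ℝ) ^ 2 * ε ≤ 1)
    (hε₁ : ε₁ ≤ 1 / 4) (hε₁b : ε₁ ≤ b) (hε₁c : 4 * ε₁ ≤ c)
    {dom : Set (Site 4 → Fin 4 → (Matrix n n ℂ)ˣ)} (hdom : dom ⊆ sfClass 4 L Nper ε₁ 0)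
    (h16 : NE3EnergyRateWCov 4 (sfClass 4 L Nper ε) L Nper b (gradConst 4 c) C Λ₁ Λ₂' dom)
    (h3 : LeafH3sup 4 L Nper ε b c dom)
    (sel : ℕ → (Site 4 → Fin 4 → (Matrix n n ℂ)ˣ) → (Site 4 → Fin 4 → (Matrix n n ℂ)ˣ))
    (hsel : ∀ V ∈ dom, ∀ k : ℕ, IsMinimiser 4 (sfClass 4 L Nper ε) L Nper k V (sel k V))
    (hreg : ∀ V ∈ dom, ∀ k : ℕ, RegularSup 4 L Nper b c k (sel k V))
    {θ γ₃ l₁ θ₃ : ℝ} (hθ : 0 < θ) (hθ6 : θ ^ 6 = ((L : ℝ))⁻¹) (hΛ₂' : 0 < Λ₂') (hγ₃ : 0 < γ₃)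
    (hγ3 : C * (wallConst 4 L * (Nper : ℝ) ^ 2 * (Real.sqrt (gradConst 4 c) * dualC2 4 L + 2 * b ^ 2 * dualC1 4 L)) ≤ γ₃ ^ 3)
    (hl₁ : 0 < l₁) (hΛl₁ : Λ₁ ≤ l₁ ^ 3) (hfit : γ₃ * θ ^ 2 ≤ l₁ * Nper)
    (hθ₃L : ((L : ℝ))⁻¹ ≤ θ₃) (hθ₃θ : θ ^ 8 ≤ θ₃) (hθ₃1 : θ₃ < 1)
    {ι' X' : Type} (Rd : Readings ι' X') (rd : ι' → (Site 4 → Fin 4 → (Matrix n n ℂ)ˣ)) (hrd : ∀ v ∈ Rd.dom, rd v ∈ dom)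
    (hact : ∀ k, ∀ v ∈ Rd.dom, Rd.act k v = minAct 4 (sfClass 4 L Nper ε) L Nper k (rd v)) (hvol : (Nper : ℝ) ^ 4 ≤ Rd.vol)
    {Car : Carriers} (uA : ℕ → ι' → Car.BgA) (uB : ℕ → ι' → Car.BgB) {k₀ : ℕ} (hk₀ : 1 ≤ k₀)
    (hdomc : ∀ K : ℕ, ∀ v ∈ Rd.dom, ∀ (u : Site 4 → (Matrix n n ℂ)ˣ) (Z : Site 4 → Fin 4 → Matrix n n ℂ) (M : ℝ),
      IsUnitarySite u → IsPeriodicSite u ((Nper * L ^ (k₀ + K) : ℕ) : ℤ) → IsSkewDir Z → IsPeriodicDir Z ((Nper * L ^ (k₀ + K) : ℕ) : ℤ) →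
      gaugeAct u (sel (k₀ + K) (rd v)) = vary (rescale L (bavg L (sel (k₀ + K + 1) (rd v)))) Z 1 →
      (∀ (x : Site 4) (κ : Fin 4), ‖Z x κ‖ ≤ M) → Car.gauge (uA K v) (Car.transport (uB K v)) ≤ M) :
    ∃ (C₃ : ℝ) (loc : ℕ → ι' → Unit → ℝ), 0 ≤ C₃ ∧
      NE3Shape (⟨Rd.dom, Rd.act, loc, Rd.vol, Rd.vol_nonneg⟩ : Readings ι' Unit) C₃ θ₃ ∧
      GaugeDominated (⟨Rd.dom, Rd.act, loc, Rd.vol, Rd.vol_nonneg⟩ : Readings ι' Unit) uA uB := by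
  classical
  -- letters
  have hL1 : 1 ≤ L := le_trans (by norm_num) hL
  have hL0 : (0 : ℝ) < L := by exact_mod_cast (show 0 < L by omega)
  have hLinv0 : 0 ≤ ((L : ℝ))⁻¹ := inv_nonneg.mpr hL0.le
  have hθ₃0 : 0 ≤ θ₃ := hLinv0.trans hθ₃L
  have h6 : θ ^ 6 ≤ 1 := by rw [hθ6]; exact inv_le_one_of_one_le₀ (by exact_mod_cast hL1)
  have hθ1 : θ ≤ 1 := (pow_le_one_iff_of_nonneg hθ.le (by norm_num)).mp h6
  have hθ8le1 : θ ^ 8 ≤ 1 := pow_le_one₀ hθ.le hθ1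
  set G : ℝ := 8 * l₁ ^ 2 * γ₃ with hGdef
  have hG0 : 0 ≤ G := by positivity
  -- the k-free averaging condition on `b` from threshold (ii): `52428800·L²·t ≤ 1`
  have ht0 : 0 ≤ t := hb.trans hbt
  obtain ⟨-, hT2, -⟩ := thresholds_four hL1 ht0 hsmall
  have hbs : 512 * (4 + 1) * (4 + 4) * (L : ℝ) ^ 2 * b ≤ 1 := by
    have e : (2 : ℝ) ^ 15 * (((4 : ℕ) : ℝ) + 1) ^ 2 * (((4 : ℕ) : ℝ) + 4) ^ 2 * (L : ℝ) ^ 2 * t = 52428800 * ((L : ℝ) ^ 2 * t) := by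
      push_cast; ring
    have h2 : 52428800 * ((L : ℝ) ^ 2 * t) ≤ 1 := by rw [← e]; exact hT2
    have hL2 : (0 : ℝ) ≤ (L : ℝ) ^ 2 := by positivity
    have h3' : (L : ℝ) ^ 2 * b ≤ (L : ℝ) ^ 2 * t := mul_le_mul_of_nonneg_left hbt hL2
    have h4 : 0 ≤ (L : ℝ) ^ 2 * b := mul_nonneg hL2 hb
    nlinarith
  -- ACTION half of NE3 from N16's record decl and N07's interface, at the record's selection (`ne3Shape_of_n16` (b))
  obtain ⟨-, hall⟩ := ne3Shape_of_n16 hL hN hb hc hbt hct hC hsmall hεt hε1 hε2 hε₁ hε₁b hε₁c hdom h16 h3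
  obtain ⟨C', hC'0, hsh⟩ := hall sel (fun V hV k => hsel V hV k) (fun V hV k => hreg V hV k)
  -- the geometric gauge profile
  refine ⟨max C' G, fun K _ _ => ∑ i ∈ range K, G * θ₃ ^ i, hC'0.trans (le_max_left _ _), ⟨hθ₃0, hθ₃1, ?_, ?_⟩, ?_⟩
  · -- action rate of the re-localised family: `|A_{k+1} − A_k| ≤ C′ L^{−k} Nper⁴ ≤ max C′ G · θ₃^k · Rd.vol`
    intro k v hv
    have hA : |minAct 4 (sfClass 4 L Nper ε) L Nper (k + 1) (rd v) - minAct 4 (sfClass 4 L Nper ε) L Nper k (rd v)|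
        ≤ C' * ((L : ℝ))⁻¹ ^ k * (Nper : ℝ) ^ 4 := hsh.action k (rd v) (hrd v hv)
    show |Rd.act (k + 1) v - Rd.act k v| ≤ max C' G * θ₃ ^ k * Rd.vol
    rw [hact (k + 1) v hv, hact k v hv]
    refine hA.trans (mul_le_mul (mul_le_mul (le_max_left _ _) (pow_le_pow_left₀ hLinv0 hθ₃L k) (pow_nonneg hLinv0 k)
      (hC'0.trans (le_max_left _ _))) hvol (by positivity) ?_)
    exact mul_nonneg (hC'0.trans (le_max_left _ _)) (pow_nonneg hθ₃0 k)
  · -- pointwise rate of the profile: increments `G·θ₃^k ≤ max C′ G · θ₃^k`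
    intro k v _ x
    show |(∑ i ∈ range (k + 1), G * θ₃ ^ i) - ∑ i ∈ range k, G * θ₃ ^ i| ≤ max C' G * θ₃ ^ k
    rw [Finset.sum_range_succ, add_sub_cancel_left, abs_of_nonneg (mul_nonneg hG0 (pow_nonneg hθ₃0 k))]
    exact mul_le_mul_of_nonneg_right (le_max_right _ _) (pow_nonneg hθ₃0 k)
  · -- the gauge liaison: closeness at level `k₀ + K ≥ 1`, then the domination convention
    intro K v hv M hM
    have hMge : G * θ₃ ^ K ≤ M := by
      have h := hM ()
      change |(∑ i ∈ range (K + 1), G * θ₃ ^ i) - ∑ i ∈ range K, G * θ₃ ^ i| ≤ M at h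
      rwa [Finset.sum_range_succ, add_sub_cancel_left, abs_of_nonneg (mul_nonneg hG0 (pow_nonneg hθ₃0 K))] at h
    have hk : 1 ≤ k₀ + K := le_trans hk₀ (Nat.le_add_right k₀ K)
    have hfit' : γ₃ * (θ ^ (k₀ + K)) ^ 2 ≤ l₁ * Nper := fit_of_fit_one hγ₃.le hθ.le hθ1 hfit hk
    have hregB : Regular 4 L Nper b (gradConst 4 c) (k₀ + K + 1) (sel (k₀ + K + 1) (rd v)) :=
      (hreg (rd v) (hrd v hv) (k₀ + K + 1)).regular
    obtain ⟨u, Z, hu, hup, hZs, hZp, hrepr, hZ, -, -, -⟩ :=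
      closeness_of_ne3EnergyRateWCov hL hN hθ hθ6 hb hbs (gradConst_nonneg (d := 4) c) hC hΛ₂' h16 hγ₃ hγ3 hl₁ hΛl₁ hk hfit'
        (hrd v hv) (hsel (rd v) (hrd v hv) (k₀ + K)) (hsel (rd v) (hrd v hv) (k₀ + K + 1)) hregB
    have hrate : θ ^ (8 * (k₀ + K)) ≤ θ₃ ^ K :=
      calc θ ^ (8 * (k₀ + K)) = (θ ^ 8) ^ (k₀ + K) := pow_mul θ 8 (k₀ + K)
        _ ≤ (θ ^ 8) ^ K := pow_le_pow_of_le_one (pow_nonneg hθ.le 8) hθ8le1 (Nat.le_add_left K k₀)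
        _ ≤ θ₃ ^ K := pow_le_pow_left₀ (pow_nonneg hθ.le 8) hθ₃θ K
    have hZ' : ∀ (x : Site 4) (κ : Fin 4), ‖Z x κ‖ ≤ M := fun x κ =>
      ((hZ x κ).trans (mul_le_mul_of_nonneg_left hrate hG0)).trans hMge
    exact hdomc K v hv u Z M hu hup hZs hZp hrepr hZ'

end N16

end Summit.QuantumFields.YangMills.BalabanUVNodes.N19InEdgesAtRecord

end
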